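import Summits.CriticalPhenomena.PercolationContinuityZ3.Theorems.PercNearOneGluingNoHeavyLowerTailSahiE3ProdRow03UnionMeasure
import Summits.CriticalPhenomena.PercolationContinuityZ3.Theorems.PercNearOneGluingNoHeavyLowerTailSahiE4UnionRowFacts
import Mathlib.Tactic.LinearCombination
import HarnessLib

/-!
# `NoHeavyLowerTail` (crux stmt-CriticalPhenomena-4575), Sahi programme P4 — ★ THE PRODUCT-ROW RUNG `E₃(u₀u₃, u₁, u₂) ≥ 0`, lattice level

Support file (cell `prim-l12`, seat P4, generation 38; `--supports stmt-CriticalPhenomena-4575`).  No definitions, no named facts, no sorries;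
standard axioms.  `γ`, `β` finite preorders with probability weights `μ`, `ν`; `μ` Sahi-positive of order 2 (positively associated
[Sahi2008, §2]); `ν` Sahi-positive of order 3 (hence of order 2, `SahiPositive.of_succ`); `a : Fin 4 → γ → [0,1]` and `b : Fin 4 → β → [0,1]`
monotone, `b_3 = 0`; `u_i = a_i ⊕ b_i` on `γ × β`.
THEOREM `sahiE_three_prodRow03_orThree_nonneg_of_sahiPositive`: if `E₃(a_i,a_j,a_k) ≥ 0` on the four sub-triples, the six order-3 product
rows `E₃(a_ia_j, a_k, a_l) ≥ 0` and `E₄(a) ≥ 0` hold on `γ` (the `H₄⁺` rows of `a`), then `E₃^{μ⊗ν}(u₀u₃, u₁, u₂) ≥ 0` for EVERY monotone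
block on a Sahi-3-positive lattice feeding the members `0, 1, 2`.  All Harris rows (`a`: hold and fail form, `SahiE4UnionHold.rowH_…/rowF_…`;
`b`: `rowH_…` for `ν`) and `E₃(b) ≥ 0` (from `SahiPositive ν 3`) are discharged here.  With `…SahiE3ProductRowUnionLattice`/`…Three`
(`E₃(u₀u₁,u₂,u₃)`) and `…SahiE4UnionThreeLattice` (`E₄`), every `H₄⁺` row of the OR family with a three-member block is now a theorem at
lattice level.  HONEST FRAMING: nothing here is Sahi's conjecture itself. [this work]
-/

noncomputable section

namespace Summit.CriticalPhenomena.PercolationContinuityZ3.Theorems.SahiE3ProdRow03Union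

open Finset Function Literature.Combinatorics.Sahi2008
open Summit.CriticalPhenomena.PercolationContinuityZ3.Theorems.SahiE4UnionHold
open Summit.CriticalPhenomena.PercolationContinuityZ3.Theorems.SahiE4UnionThree

variable {γ β : Type*} [Fintype γ] [Fintype β] [Preorder γ] [Preorder β]

set_option maxHeartbeats 4000000 in
/-- **Order-3 product-row rung `E₃(u₀u₃, u₁, u₂) ≥ 0`, general three-member block, LATTICE level.**  See the module docstring. [this work] -/
theorem sahiE_three_prodRow03_orThree_nonneg_of_sahiPositive (μ : γ → ℝ) (ν : β → ℝ)
    (hμ0 : ∀ t, 0 ≤ μ t) (hμ1 : ∑ t, μ t = 1) (hν0 : ∀ t, 0 ≤ ν t) (hν1 : ∑ t, ν t = 1) (hμ2 : SahiPositive μ 2) (hν3 : SahiPositive ν 3)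
    (a : Fin 4 → γ → ℝ) (b : Fin 4 → β → ℝ) (ha0 : ∀ i t, 0 ≤ a i t) (ha1 : ∀ i t, a i t ≤ 1) (ham : ∀ i, Monotone (a i))
    (hb0 : ∀ i t, 0 ≤ b i t) (hb1 : ∀ i t, b i t ≤ 1) (hbm : ∀ i, Monotone (b i)) (hbz3 : ∀ t, b 3 t = 0)
    (hha_e3h_012 : 0 ≤ sahiE μ 3 ![a 0, a 1, a 2])
    (hha_e3h_013 : 0 ≤ sahiE μ 3 ![a 0, a 1, a 3])
    (hha_e3h_023 : 0 ≤ sahiE μ 3 ![a 0, a 2, a 3])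
    (hha_e3h_123 : 0 ≤ sahiE μ 3 ![a 1, a 2, a 3])
    (hha_p3h_01 : 0 ≤ sahiE μ 3 ![a 0 * a 1, a 2, a 3])
    (hha_p3h_02 : 0 ≤ sahiE μ 3 ![a 0 * a 2, a 1, a 3])
    (hha_p3h_12 : 0 ≤ sahiE μ 3 ![a 1 * a 2, a 0, a 3])
    (hha_p3h_03 : 0 ≤ sahiE μ 3 ![a 0 * a 3, a 1, a 2])
    (hha_p3h_13 : 0 ≤ sahiE μ 3 ![a 1 * a 3, a 0, a 2])
    (hha_p3h_23 : 0 ≤ sahiE μ 3 ![a 2 * a 3, a 0, a 1])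
    (hha_e4h : 0 ≤ sahiE μ 4 a)
    : 0 ≤ sahiE (fun p : γ × β => μ p.1 * ν p.2) 3 ![(fun (i : Fin 4) (p : γ × β) => a i p.1 + b i p.2 - a i p.1 * b i p.2) 0 * (fun (i : Fin 4) (p : γ × β) => a i p.1 + b i p.2 - a i p.1 * b i p.2) 3, (fun (i : Fin 4) (p : γ × β) => a i p.1 + b i p.2 - a i p.1 * b i p.2) 1, (fun (i : Fin 4) (p : γ × β) => a i p.1 + b i p.2 - a i p.1 * b i p.2) 2] := by
  have hν2 : SahiPositive ν 2 := SahiPositive.of_succ hν0 hν1 hν3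
  exact sahiE_three_prodRow03_orThree_nonneg μ ν hμ0 hμ1 hν0 hν1 a b ha0 ha1 hb0 hb1 hbz3
    (by have h := rowH_0_1 μ hμ2 a ha0 ham; linarith) (by have h := rowH_0_2 μ hμ2 a ha0 ham; linarith) (by have h := rowH_0_12 μ hμ2 a ha0 ham; linarith) (by have h := rowH_0_3 μ hμ2 a ha0 ham; linarith) (by have h := rowH_0_13 μ hμ2 a ha0 ham; linarith) (by have h := rowH_0_23 μ hμ2 a ha0 ham; linarith) (by have h := rowH_0_123 μ hμ2 a ha0 ham; linarith) (by have h := rowH_1_2 μ hμ2 a ha0 ham; linarith) (by have h := rowH_1_02 μ hμ2 a ha0 ham; linarith) (by have h := rowH_1_3 μ hμ2 a ha0 ham; linarith) (by have h := rowH_1_03 μ hμ2 a ha0 ham; linarith) (by have h := rowH_1_23 μ hμ2 a ha0 ham; linarith) (by have h := rowH_1_023 μ hμ2 a ha0 ham; linarith) (by have h := rowH_01_2 μ hμ2 a ha0 ham; linarith) (by have h := rowH_01_3 μ hμ2 a ha0 ham; linarith) (by have h := rowH_01_23 μ hμ2 a ha0 ham; linarith) (by have h := rowH_2_3 μ hμ2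 a ha0 ham; linarith) (by have h := rowH_2_03 μ hμ2 a ha0 ham; linarith) (by have h := rowH_2_13 μ hμ2 a ha0 ham; linarith) (by have h := rowH_2_013 μ hμ2 a ha0 ham; linarith) (by have h := rowH_02_3 μ hμ2 a ha0 ham; linarith) (by have h := rowH_02_13 μ hμ2 a ha0 ham; linarith) (by have h := rowH_12_3 μ hμ2 a ha0 ham; linarith) (by have h := rowH_12_03 μ hμ2 a ha0 ham; linarith) (by have h := rowH_012_3 μ hμ2 a ha0 ham; linarith) (by have h := rowF_0_1 μ hμ1 hμ2 a ha0 ham; linarith) (by have h := rowF_0_2 μ hμ1 hμ2 a ha0 ham; linarith) (by have h := rowF_0_12 μ hμ1 hμ2 a ha0 ha1 ham; linarith) (by have h := rowF_0_3 μ hμ1 hμ2 a ha0 ham; linarith) (by have h := rowF_0_13 μ hμ1 hμ2 a ha0 ha1 ham; linarith) (by have h := rowF_0_23 μ hμ1 hμ2 a ha0 ha1 ham; linarith) (by have h := rowF_0_123 μ hμ1 hμ2 a ha0 ha1 ham; linarith) (by have h := rowF_1_2 μ hμ1 hμ2 a ha0 ham; linarith) (by have h := rowF_1_02 μ hμ1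 hμ2 a ha0 ha1 ham; linarith) (by have h := rowF_1_3 μ hμ1 hμ2 a ha0 ham; linarith) (by have h := rowF_1_03 μ hμ1 hμ2 a ha0 ha1 ham; linarith) (by have h := rowF_1_23 μ hμ1 hμ2 a ha0 ha1 ham; linarith) (by have h := rowF_1_023 μ hμ1 hμ2 a ha0 ha1 ham; linarith) (by have h := rowF_01_2 μ hμ1 hμ2 a ha0 ha1 ham; linarith) (by have h := rowF_01_3 μ hμ1 hμ2 a ha0 ha1 ham; linarith) (by have h := rowF_01_23 μ hμ1 hμ2 a ha0 ha1 ham; linarith) (by have h := rowF_2_3 μ hμ1 hμ2 a ha0 ham; linarith) (by have h := rowF_2_03 μ hμ1 hμ2 a ha0 ha1 ham; linarith) (by have h := rowF_2_13 μ hμ1 hμ2 a ha0 ha1 ham; linarith) (by have h := rowF_2_013 μ hμ1 hμ2 a ha0 ha1 ham; linarith) (by have h := rowF_02_3 μ hμ1 hμ2 a ha0 ha1 ham; linarith) (by have h := rowF_02_13 μ hμ1 hμ2 a ha0 ha1 ham; linarith) (by have h := rowF_12_3 μ hμ1 hμ2 a ha0 ha1 ham; linarith) (by have h := rowF_12_03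 μ hμ1 hμ2 a ha0 ha1 ham; linarith) (by have h := rowF_012_3 μ hμ1 hμ2 a ha0 ha1 ham; linarith) hha_e3h_012 hha_e3h_013 hha_e3h_023 hha_e3h_123 hha_p3h_01 hha_p3h_02 hha_p3h_12 hha_p3h_03 hha_p3h_13 hha_p3h_23 hha_e4h
    (by have h := rowH_0_1 ν hν2 b hb0 hbm; linarith) (by have h := rowH_0_2 ν hν2 b hb0 hbm; linarith) (by have h := rowH_1_2 ν hν2 b hb0 hbm; linarith) (by have h := rowH_01_2 ν hν2 b hb0 hbm; linarith) (by have h := rowH_1_02 ν hν2 b hb0 hbm; linarith) (by have h := rowH_0_12 ν hν2 b hb0 hbm; linarith) (hν3 ![b 0, b 1, b 2] (fun i t => by fin_cases i <;> exact hb0 _ t) (fun i => by fin_cases i <;> exact hbm _))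

end Summit.CriticalPhenomena.PercolationContinuityZ3.Theorems.SahiE3ProdRow03Union

end
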